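import Literature.MathematicalPhysics.QuantumFieldTheory.Balaban1983to89.B15Claim189Assembly
import Literature.MathematicalPhysics.QuantumFieldTheory.Balaban1983to89.B15Eq13Concrete
import Literature.MathematicalPhysics.QuantumFieldTheory.Balaban1983to89.B15Sect1Instances
import Literature.MathematicalPhysics.QuantumFieldTheory.Balaban1983to89.B15Sect1ChartInstances

/-!
# `Balaban1983to89.B15Claim189AtInstances` — T. Bałaban, *Large field renormalization. I. The basic step of the 𝐑 operation*,
# Commun. Math. Phys. **122** (1989) 175–202 [Balaban1989LargeFieldI] = «[IV]», (1.89) p. 198: p29's lettered one-theorem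
# assembly `B15Claim189Assembly.claim189_assembly` (p387003) AT PRINT'S OWN INSTANCES — the lettered data `Setting189` built from
# r11's concrete functions [III] (2.17) ∕ (1.3) ∕ (1.88) (`B14Eq216Concrete`, `B15Eq13Concrete` p386016) and instances (1.20)–(1.21),
# (1.24), (1.75) (`B15Sect1Instances` p385406)

statement-level skeleton of published theorems with citation tags; proofs where landed; nothing here is a claim about
the Yang–Mills mass gap

PDF held: `paper:balaban1989-cmp122-large-field-i` (journal page = PDF page + 174); p. 198 [PDF 24] ((1.89) and the sentences
after it) read on the ×2 render `run/shared/lean/pub/pub-balaban/b2b-balaban-ref1/pages/1989-cmp122-large-field-I/1989-cmp122-large-field-I-p024-x2.png`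
(crop of the (1.89)–(1.91) band read 2026-08-25), pp. 199–200 on the text layer.

CITATION HEADER / WHAT IS REPRODUCED (mega-formalization `lit-balaban`, HOME `run/shared/lean/pub/lit-balaban/`; unit
`lit-balaban-r11` gen 110, PROXY CONSTITUENT for block B15 under the lead's ruling G.5-61).  The junction below was WRITTEN by the
DEFINITIONS steward r20 gen 70 as the scratch twin `Junction189Twin.lean` (`lit-balaban-r20/tools/g70/scratch/`, hub `lean check`
rc 0 with the three members' definitions copied because their oleans were unbuilt) and is filed here, with imports instead of copies,
as the HONEST SCOPE (vii) junction that p29's `B15Claim189Assembly` names.  SKELETON row served (cells only; the CLAIM head of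
B15.Eq1.89 stays `typed` per the lead g18 word 2026-08-24T23:15:05Z): **B15.Eq1.89**.

THE PRINT (p. 198, after (1.89)): *"We have assumed that β ≦ 1/4. The equality χ_h(Ω_h∩Z_h) = 1 is immediate, so we have to prove
that χ″_k = 1."*

WHAT IS PROVED (one `def` WITH BODY + 7 theorems; v1.1 = v1 + §4 `new189_iff_chart`, append-only; 0 `def … : Prop` facts, 0 `sorry`, standard axioms).
§1 **`setting189Std`** — PRINT'S OWN INSTANCE of p29's lettered data `Setting189`: configuration space `C := MSField P G × ((j : ℕ) →
   VecField P j 𝔤)` (the pair `(V, B′)` of the multi-scale field and the (1.82) chart variable); `U″_{k,Z} := bgPPZstd … V` ((1.21));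
   `χ_k(Ω_k^{∼4}) := (chi217 … (ε k) k V_k = 1)` ([III] (2.17) over the `LM₂R_k`-cubes `XΩ4` of `Ω_k^{∼4}`); `χ_{k,Λ} := chi175std …`
   ((1.75)); `χ′ := chiP B′` — the (1.82) function as a LETTER (its instance is p29's `B15Sect1ChartInstances.chiPrime182std`,
   p386208 ✓ e8e34ae8f0ce; χ′ acts in p29's assembly only as a letter, HONEST SCOPE (iii) there)
   — §4 `new189_iff_chart` (v1.1) passes p29's instance `chiPrime182std` (p386208 ✓) for it, so all four remaining functions are
   print's own objects;
   `U_{h,□}((1, V_h)) := ukBox bg M₁ □^{∼4} h (oneOn Ω″^{∼2}_{h+1} h V_h)` and `U_{h,□}(V_h) := ukBox bg M₁ □^{∼4} h V_h` ([III] (2.16),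
   the configurations of r11's `chiHalf` ∕ `chi13`); the deviations `devV''`/`dev97`/`dev0` of the intermediate configurations
   `U_{h,□}(V″)`, (1.97), `U₀^{ū₀}` stay letters of `V` (HONEST SCOPE (ii) of p387003: no tree construction of (1.90)/(1.97)).
§2 **`new189_iff`** — the REMAINING functions of (1.89) at these instances ARE r11's concrete [III] (2.17) `χ_k(Ω_k^{∼4}) = 1`, (1.75)
   `chi175std`, (1.88) `chiHalf = 1` and the (1.82) letter; **`chiH_iff`** — `χ_h(Ω_h∩Z_h)` IS r11's concrete (1.3)-function at
   level `h` `= 1`; **`chiPP_iff`** — the dropped `χ″_k` IS r11's (1.24) instance `chi124std … k₀ (k − h)` at `U″_{k,Z}(V)`.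
§3 **`eq189_at_instances`** ∕ **`eq189_dropped_at_instances`** — (1.89) AT PRINT'S INSTANCES: from the kernel implication
   `Claim189 (new189 D) (chiPP D)` (resp. `… (dropped189 D)`) at `D := setting189Std …`, for a pair `(V, B′)` with the four concrete
   remaining functions, r11's concrete `χ″_k` holds (resp. and `χ_h(Ω_h∩Z_h) = 1`); **`claim189_std`** — that implication itself AT
   THE INSTANCES, i.e. p29's `claim189_assembly` specialised to `setting189Std`: its printed-leaf hypotheses ((1.90)–(1.91),
   (1.93)–(1.95) on the half domain; p. 199's two (1.91)-type bounds and (1.80) on the ℍ-domains; print's numerics and p. 200's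
   `X′` ∕ *"j = k"* ∕ *"smaller than α"* clauses; the (1.88) cube cover) now speak of print's own objects.
HONEST SCOPE.  Bookkeeping only: no analytic leaf is proved here — the leaves (1.90)–(1.91), (1.93)–(1.95), p. 199's bounds, (1.80)
stay hypotheses of p29's assembly exactly as in p387003 (whence the CLAIM head of row B15.Eq1.89 stays `typed`).
-/

noncomputable section

namespace Literature.MathematicalPhysics.QuantumFieldTheory.Balaban1983to89.B15Claim189AtInstances

open Literature.MathematicalPhysics.QuantumFieldTheory.Balaban1983to89
open B15DeterminingSets B14.Eq213DetSet B14.Eq216Concrete B15.PrelimIntegrations B15StandardRep GaugeField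
open B15.BasicStep B15Chi124DetSets B8Eq17ClassAkV1
open B15Eq13Concrete B15Sect1Instances B15Claim189Assembly B15Sect1ChartInstances
open Literature.MathematicalPhysics.QuantumFieldTheory.BalabanImbrieJaffe1984to88.BIJ85Eq453GaugeField
open Set
open scoped BigOperators

variable {P : Params}
variable {G : Type*} [GaugeGroup G] {av : ∀ j, Averaging P j G} (bg : DetBackground P G av) (M₁ : ℕ)

variable {𝔤 : Type*}
variable {ι κ : Type*} (plaqT : ι → Set (Plaq P 0)) (enl4 : ι → Set (Site P 0))
variable (plaqT4 : κ → Set (Plaq P 0)) (enl44 : κ → Set (Site P 0)) (XΩ4 : Finset κ)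
variable (Ω Zpp : ℕ → Set (Site P 0)) (Z Λ OmT ΩppT2 : Set (Site P 0)) (h k₀ k : ℕ) (β L₀ α δ B₃ B₅ M O1 : ℝ) (ε : ℕ → ℝ)
variable (dist : Plaq P 0 → ℝ) (Xhalf XH : Finset ι) (boxOf : Plaq P 0 → ι)
variable (chiP : ((j : ℕ) → VecField P j 𝔤) → Prop)
variable (devV'' dev97 dev0 : MSField P G → Plaq P 0 → ℝ)

/-- PRINT'S INSTANCE of the lettered data of (1.89) (p29's HONEST SCOPE (vii)): configuration space `C := MSField P G × ((j : ℕ) →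
VecField P j 𝔤)` (the pair `(V, B′)`); `U″_{k,Z} := bgPPZstd … V` ((1.21)); `χ_k(Ω_k^{∼4}) := (chi217 bg M₁ XΩ4 plaqT4 enl44 (ε k) k V_k
= 1)` ([III] (2.17) over the `LM₂R_k`-cubes `XΩ4` of `Ω_k^{∼4}`); `χ_{k,Λ} := chi175std bg M₁ Z Λ k Ω (ε k) η V_k` ((1.75));
`χ′ := chiP B′` (p29's `chiPrime182std …`, p386208 pending, as a letter); `U_{h,□}((1, V_h)) := ukBox bg M₁ □^{∼4} h (oneOn Ω″^{∼2}_{h+1} h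
V_h)` and `U_{h,□}(V_h) := ukBox bg M₁ □^{∼4} h V_h` ([III] (2.16), r11's `chiHalf` ∕ `chi13` configurations); cube families
`halfcubes := ↑Xhalf`, `cubesH := ↑XH`; `L := P.L`, `η := P.eta k`; the numbers, `dist(p, Λ)`, `boxOf`, `Ω″^∼_{h+1} = OmT` and the
three deviations `devV''`/`dev97`/`dev0` (functions of `V`) as given. [cite: Balaban1989LargeFieldI, (1.89) p.198; (1.21) p.181, (1.75) p.193, (1.88) p.198] -/
def setting189Std : Setting189 P G (MSField P G × ((j : ℕ) → VecField P j 𝔤)) ι where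
  Ω := Ω
  Zpp := Zpp
  OmT := OmT
  h := h
  k₀ := k₀
  k := k
  β := β
  L₀ := L₀
  L := (P.L : ℝ)
  η := P.eta k
  ε := ε
  α := α
  δ := δ
  B₃ := B₃
  B₅ := B₅
  M := M
  O1 := O1
  dist := dist
  chiΩ4 := fun U => chi217 bg M₁ XΩ4 plaqT4 enl44 (ε k) k (U.1 k) = 1
  chiΛ := fun U => chi175std bg M₁ Z Λ k Ω (ε k) (P.eta k) (U.1 k)
  chi' := fun U => chiP U.2
  plaqT := plaqT
  halfcubes := ↑Xhalf
  Uhalf := fun U c => ukBox bg M₁ (enl4 c) h (oneOn ΩppT2 h (U.1 h))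
  boxOf := boxOf
  cubesH := ↑XH
  UboxH := fun U c => ukBox bg M₁ (enl4 c) h (U.1 h)
  Upp := fun U => bgPPZstd bg M₁ Ω Zpp Z h k U.1
  devV'' := fun U => devV'' U.1
  dev97 := fun U => dev97 U.1
  dev0 := fun U => dev0 U.1

/-- **JUNCTION 1 — the REMAINING functions of (1.89) at print's instances ARE r11's concrete [III] (2.17) `χ_k(Ω_k^{∼4}) = 1`,
r11's (1.75) `chi175std`, r11's (1.88) `chiHalf = 1` and the (1.82) letter** (`h ≤ k`). [cite: Balaban1989LargeFieldI, (1.89) p.198; (1.75) p.193, (1.82) p.196, (1.88) p.198] -/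
theorem new189_iff (hhk : h ≤ k) (U : MSField P G × ((j : ℕ) → VecField P j 𝔤)) :
    new189 (setting189Std bg M₁ plaqT enl4 plaqT4 enl44 XΩ4 Ω Zpp Z Λ OmT ΩppT2 h k₀ k β L₀ α δ B₃ B₅ M O1 ε dist Xhalf XH boxOf
        chiP devV'' dev97 dev0) U ↔
      chi217 bg M₁ XΩ4 plaqT4 enl44 (ε k) k (U.1 k) = 1 ∧
      chi175std bg M₁ Z Λ k Ω (ε k) (P.eta k) (U.1 k) ∧
      chiHalf bg M₁ Xhalf plaqT enl4 ε h ΩppT2 (U.1 h) = 1 ∧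
      chiP U.2 := by
  rw [chiHalf_eq_one_iff bg M₁ hhk]
  exact Iff.rfl

/-- **JUNCTION 2 — the deleted `χ_h(Ω_h∩Z_h)` at print's instances IS r11's concrete (1.3) function at level `h` `= 1`** (`h ≤ k`). [cite: Balaban1989LargeFieldI, (1.89) p.198; (1.3) p.178] -/
theorem chiH_iff (hhk : h ≤ k) (U : MSField P G × ((j : ℕ) → VecField P j 𝔤)) :
    chiH (setting189Std bg M₁ plaqT enl4 plaqT4 enl44 XΩ4 Ω Zpp Z Λ OmT ΩppT2 h k₀ k β L₀ α δ B₃ B₅ M O1 ε dist Xhalf XH boxOf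
        chiP devV'' dev97 dev0) U ↔
      chi13 bg M₁ XH plaqT enl4 ε h U.1 = 1 := by
  rw [chi13_eq_one_iff bg M₁ hhk]
  exact Iff.rfl

/-- **JUNCTION 3 — the deleted `χ″_k` at print's instances IS r11's concrete (1.24) `chi124std` at the top level `n = N = k − h`**
(`h ≤ k`; r11's `chi124std_top`). [cite: Balaban1989LargeFieldI, (1.89) p.198; (1.21) p.181, (1.24) pp.181–182] -/
theorem chiPP_iff (hhk : h ≤ k) (U : MSField P G × ((j : ℕ) → VecField P j 𝔤)) :
    chiPP (setting189Std bg M₁ plaqT enl4 plaqT4 enl44 XΩ4 Ω Zpp Z Λ OmT ΩppT2 h k₀ k β L₀ α δ B₃ B₅ M O1 ε dist Xhalf XH boxOf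
        chiP devV'' dev97 dev0) U ↔
      chi124std bg M₁ Ω Zpp Z h k k₀ (k - h) β L₀ ε (P.L : ℝ) (P.eta k) U.1 := by
  rw [chi124std_top bg M₁ Ω Zpp Z hhk]
  exact Iff.rfl

/-- **(1.89) AT PRINT'S INSTANCES** — *"with the new functions introduced in the integral, we can drop the function χ″_k"*: from
p29's kernel implication `Claim189 (new189 D) (chiPP D)` at `D := setting189Std …` (p29's `claim189_assembly` delivers it for any
`D` under the printed leaves), for a pair `(V, B′)` with `χ_k(Ω_k^{∼4})(V_k) = 1`, `χ_{k,Λ}(V_k)`, `χ_{h,1/2}((1, V_h)) = 1`, `χ′(B′)`,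
r11's concrete `χ″_k = χ_k^{(k−h)}` HOLDS at `V` (`h ≤ k`). [cite: Balaban1989LargeFieldI, (1.89) p.198, pp.199–200] -/
theorem eq189_at_instances (hhk : h ≤ k)
    (h189 : Claim189
      (new189 (setting189Std bg M₁ plaqT enl4 plaqT4 enl44 XΩ4 Ω Zpp Z Λ OmT ΩppT2 h k₀ k β L₀ α δ B₃ B₅ M O1 ε dist Xhalf XH
        boxOf chiP devV'' dev97 dev0))
      (chiPP (setting189Std bg M₁ plaqT enl4 plaqT4 enl44 XΩ4 Ω Zpp Z Λ OmT ΩppT2 h k₀ k β L₀ α δ B₃ B₅ M O1 ε dist Xhalf XH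
        boxOf chiP devV'' dev97 dev0)))
    (V : MSField P G) (B' : (j : ℕ) → VecField P j 𝔤)
    (hΩ4 : chi217 bg M₁ XΩ4 plaqT4 enl44 (ε k) k (V k) = 1) (hΛ : chi175std bg M₁ Z Λ k Ω (ε k) (P.eta k) (V k))
    (hhalf : chiHalf bg M₁ Xhalf plaqT enl4 ε h ΩppT2 (V h) = 1) (hchi' : chiP B') :
    chi124std bg M₁ Ω Zpp Z h k k₀ (k - h) β L₀ ε (P.L : ℝ) (P.eta k) V := by
  have hnew : new189 (setting189Std bg M₁ plaqT enl4 plaqT4 enl44 XΩ4 Ω Zpp Z Λ OmT ΩppT2 h k₀ k β L₀ α δ B₃ B₅ M O1 ε dist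
      Xhalf XH boxOf chiP devV'' dev97 dev0) (V, B') :=
    (new189_iff bg M₁ plaqT enl4 plaqT4 enl44 XΩ4 Ω Zpp Z Λ OmT ΩppT2 h k₀ k β L₀ α δ B₃ B₅ M O1 ε dist Xhalf XH boxOf chiP
      devV'' dev97 dev0 hhk (V, B')).2 ⟨hΩ4, hΛ, hhalf, hchi'⟩
  exact (chiPP_iff bg M₁ plaqT enl4 plaqT4 enl44 XΩ4 Ω Zpp Z Λ OmT ΩppT2 h k₀ k β L₀ α δ B₃ B₅ M O1 ε dist Xhalf XH boxOf chiP
    devV'' dev97 dev0 hhk (V, B')).1 (h189 _ hnew)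

/-- The same with the FULL deleted product `χ_h(Ω_h∩Z_h)χ″_k` (p29's `claim189_assembly_with_chiH`): both r11 functions follow. [cite: Balaban1989LargeFieldI, (1.89) p.198, pp.199–200] -/
theorem eq189_dropped_at_instances (hhk : h ≤ k)
    (h189 : Claim189
      (new189 (setting189Std bg M₁ plaqT enl4 plaqT4 enl44 XΩ4 Ω Zpp Z Λ OmT ΩppT2 h k₀ k β L₀ α δ B₃ B₅ M O1 ε dist Xhalf XH
        boxOf chiP devV'' dev97 dev0))
      (dropped189 (setting189Std bg M₁ plaqT enl4 plaqT4 enl44 XΩ4 Ω Zpp Z Λ OmT ΩppT2 h k₀ k β L₀ α δ B₃ B₅ M O1 ε dist Xhalf XH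
        boxOf chiP devV'' dev97 dev0)))
    (V : MSField P G) (B' : (j : ℕ) → VecField P j 𝔤)
    (hΩ4 : chi217 bg M₁ XΩ4 plaqT4 enl44 (ε k) k (V k) = 1) (hΛ : chi175std bg M₁ Z Λ k Ω (ε k) (P.eta k) (V k))
    (hhalf : chiHalf bg M₁ Xhalf plaqT enl4 ε h ΩppT2 (V h) = 1) (hchi' : chiP B') :
    chi13 bg M₁ XH plaqT enl4 ε h V = 1 ∧ chi124std bg M₁ Ω Zpp Z h k k₀ (k - h) β L₀ ε (P.L : ℝ) (P.eta k) V := by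
  have hnew : new189 (setting189Std bg M₁ plaqT enl4 plaqT4 enl44 XΩ4 Ω Zpp Z Λ OmT ΩppT2 h k₀ k β L₀ α δ B₃ B₅ M O1 ε dist
      Xhalf XH boxOf chiP devV'' dev97 dev0) (V, B') :=
    (new189_iff bg M₁ plaqT enl4 plaqT4 enl44 XΩ4 Ω Zpp Z Λ OmT ΩppT2 h k₀ k β L₀ α δ B₃ B₅ M O1 ε dist Xhalf XH boxOf chiP
      devV'' dev97 dev0 hhk (V, B')).2 ⟨hΩ4, hΛ, hhalf, hchi'⟩
  obtain ⟨hH, hPP⟩ := h189 _ hnew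
  exact ⟨(chiH_iff bg M₁ plaqT enl4 plaqT4 enl44 XΩ4 Ω Zpp Z Λ OmT ΩppT2 h k₀ k β L₀ α δ B₃ B₅ M O1 ε dist Xhalf XH boxOf chiP
      devV'' dev97 dev0 hhk (V, B')).1 hH,
    (chiPP_iff bg M₁ plaqT enl4 plaqT4 enl44 XΩ4 Ω Zpp Z Λ OmT ΩppT2 h k₀ k β L₀ α δ B₃ B₅ M O1 ε dist Xhalf XH boxOf chiP
      devV'' dev97 dev0 hhk (V, B')).1 hPP⟩

/-- **(1.89) AT PRINT'S INSTANCES FROM THE PRINTED LEAVES** — p29's `claim189_assembly` (p387003) specialised to `setting189Std`: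
the lettered objects of its hypotheses are now print's own (`U″_{k,Z} = bgPPZstd …`, `U_{h,□}((1,V_h)) = ukBox … (oneOn …)`,
`χ_k(Ω_k^{∼4})`, `χ_{k,Λ} = chi175std …`, `χ_{h,1/2}` per cube), the printed leaves ((1.90)–(1.91) `L91h`, (1.93)–(1.95) `L95` on the
half domain; p. 199's two (1.91)-type bounds `L91`/`L97` and (1.80) `L80` on the ℍ-domains) keep p29's printed form over the
deviation letters `devV''`/`dev97`/`dev0`, and the numerics are print's (`α = 1/12`, `0 ≦ β ≦ 1/4`, `2 ≦ L₀`, `L₀² ≦ L`,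
`0 ≦ ε_i ≦ 1/10`; p. 200's `X′`, *"j = k"*, *"smaller than α"*; p. 199's flow inequality; the (1.88) cube cover).  Conclusion:
`Claim189 (new189 D) (chiPP D)` at `D := setting189Std …`; with `new189_iff`/`chiPP_iff` (or `eq189_at_instances`) r11's concrete
`χ″_k` = `chi124std … k₀ (k − h)` holds for every `(V, B′)` with the four concrete remaining functions.  Nothing but
`claim189_assembly` is used. [cite: Balaban1989LargeFieldI, (1.89) p.198, pp.199–200] -/
theorem claim189_std (hhk : h ≤ k₀) (hk : k₀ + 2 ≤ k)
    (hΩ : ∀ i, Ω (i + 1) ⊆ Ω i) (hΩtop : Ω k ⊆ Ω (k + 1))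
    (hα : α = 1 / 12) (hβ0 : 0 ≤ β) (hβ : β ≤ 1 / 4) (hL₀ : 2 ≤ L₀) (hL₀L : L₀ ^ 2 ≤ (P.L : ℝ))
    (hε0 : ∀ i, 0 ≤ ε i) (hε1 : ∀ i, ε i ≤ 1 / 10) (hB : 0 ≤ O1 * B₃ * B₅ * M ^ 5)
    (hδ : 0 ≤ δ) (hdist : ∀ p, 0 ≤ dist p)
    {X' : ℝ} (hX' : ∀ j, 2 + X (setting189Std bg M₁ plaqT enl4 plaqT4 enl44 XΩ4 Ω Zpp Z Λ OmT ΩppT2 h k₀ k β L₀ α δ B₃ B₅ M O1 ε dist Xhalf XH boxOf chiP devV'' dev97 dev0) j ≤ X') (hsmall : X' * ((L₀ ^ 2) ^ (k - k₀ - 1))⁻¹ ≤ 1 / 4)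
    (hjEqK : ∀ m, k₀ < m → m < k → Ω m \ Ω (m + 1) ⊆ domK (setting189Std bg M₁ plaqT enl4 plaqT4 enl44 XΩ4 Ω Zpp Z Λ OmT ΩppT2 h k₀ k β L₀ α δ B₃ B₅ M O1 ε dist Xhalf XH boxOf chiP devV'' dev97 dev0))
    (hlast : ∀ m, k₀ < m → m < k → ∀ p ∈ plaqsOf (Ω m \ Ω (m + 1)), X (setting189Std bg M₁ plaqT enl4 plaqT4 enl44 XΩ4 Ω Zpp Z Λ OmT ΩppT2 h k₀ k β L₀ α δ B₃ B₅ M O1 ε dist Xhalf XH boxOf chiP devV'' dev97 dev0) k * Real.exp (-δ * dist p) ≤ α)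
    (hscale : ∀ j, h ≤ j → j < k → ε k * P.eta k ^ 2 ≤ ((P.L : ℝ) ^ (k - j))⁻¹ * E124 ε (P.L : ℝ) (P.eta k) k j)
    (hbox : ∀ p ∈ plaqsOf (half (setting189Std bg M₁ plaqT enl4 plaqT4 enl44 XΩ4 Ω Zpp Z Λ OmT ΩppT2 h k₀ k β L₀ α δ B₃ B₅ M O1 ε dist Xhalf XH boxOf chiP devV'' dev97 dev0)), boxOf p ∈ (↑Xhalf : Set ι) ∧ p ∈ plaqT (boxOf p))
    (L91h : ∀ U : MSField P G × ((j : ℕ) → VecField P j 𝔤), new189 (setting189Std bg M₁ plaqT enl4 plaqT4 enl44 XΩ4 Ω Zpp Z Λ OmT ΩppT2 h k₀ k β L₀ α δ B₃ B₅ M O1 ε dist Xhalf XH boxOf chiP devV'' dev97 dev0) U → ∀ p ∈ plaqsOf (half (setting189Std bg M₁ plaqT enl4 plaqT4 enl44 XΩ4 Ω Zpp Z Λ OmT ΩppT2 h k₀ k β L₀ α δ B₃ B₅ M O1 ε dist Xhalf XH boxOf chiP devV'' dev97 dev0)),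
      Ineq191 (dist1 (plaqHol (bgPPZstd bg M₁ Ω Zpp Z h k U.1) p)) (devV'' U.1 p) α (((P.L : ℝ) ^ h)⁻¹) (ε h)
        (E124 ε (P.L : ℝ) (P.eta k) k h))
    (L95 : ∀ U : MSField P G × ((j : ℕ) → VecField P j 𝔤), new189 (setting189Std bg M₁ plaqT enl4 plaqT4 enl44 XΩ4 Ω Zpp Z Λ OmT ΩppT2 h k₀ k β L₀ α δ B₃ B₅ M O1 ε dist Xhalf XH boxOf chiP devV'' dev97 dev0) U → ∀ p ∈ plaqsOf (half (setting189Std bg M₁ plaqT enl4 plaqT4 enl44 XΩ4 Ω Zpp Z Λ OmT ΩppT2 h k₀ k β L₀ α δ B₃ B₅ M O1 ε dist Xhalf XH boxOf chiP devV'' dev97 dev0)),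
      Ineq195 (devV'' U.1 p) (dist1 (plaqHol (ukBox bg M₁ (enl4 (boxOf p)) h (oneOn ΩppT2 h (U.1 h))) p)) α (((P.L : ℝ) ^ h)⁻¹)
        (ε h) (E124 ε (P.L : ℝ) (P.eta k) k h))
    (L91 : ∀ U : MSField P G × ((j : ℕ) → VecField P j 𝔤), new189 (setting189Std bg M₁ plaqT enl4 plaqT4 enl44 XΩ4 Ω Zpp Z Λ OmT ΩppT2 h k₀ k β L₀ α δ B₃ B₅ M O1 ε dist Xhalf XH boxOf chiP devV'' dev97 dev0) U → ∀ j, h ≤ j → j ≤ k → ∀ p ∈ plaqsOf (dom (setting189Std bg M₁ plaqT enl4 plaqT4 enl44 XΩ4 Ω Zpp Z Λ OmT ΩppT2 h k₀ k β L₀ α δ B₃ B₅ M O1 ε dist Xhalf XH boxOf chiP devV'' dev97 dev0) j),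
      Ineq191 (dist1 (plaqHol (bgPPZstd bg M₁ Ω Zpp Z h k U.1) p)) (dev97 U.1 p) α (((P.L : ℝ) ^ j)⁻¹) (ε j)
        (E124 ε (P.L : ℝ) (P.eta k) k j))
    (L97 : ∀ U : MSField P G × ((j : ℕ) → VecField P j 𝔤), new189 (setting189Std bg M₁ plaqT enl4 plaqT4 enl44 XΩ4 Ω Zpp Z Λ OmT ΩppT2 h k₀ k β L₀ α δ B₃ B₅ M O1 ε dist Xhalf XH boxOf chiP devV'' dev97 dev0) U → ∀ j, h ≤ j → j ≤ k → ∀ p ∈ plaqsOf (dom (setting189Std bg M₁ plaqT enl4 plaqT4 enl44 XΩ4 Ω Zpp Z Λ OmT ΩppT2 h k₀ k β L₀ α δ B₃ B₅ M O1 ε dist Xhalf XH boxOf chiP devV'' dev97 dev0) j),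
      Ineq191 (dev97 U.1 p) (dev0 U.1 p) α (((P.L : ℝ) ^ j)⁻¹) (ε j) (E124 ε (P.L : ℝ) (P.eta k) k j))
    (L80 : ∀ U : MSField P G × ((j : ℕ) → VecField P j 𝔤), new189 (setting189Std bg M₁ plaqT enl4 plaqT4 enl44 XΩ4 Ω Zpp Z Λ OmT ΩppT2 h k₀ k β L₀ α δ B₃ B₅ M O1 ε dist Xhalf XH boxOf chiP devV'' dev97 dev0) U → ∀ j, h ≤ j → j ≤ k → ∀ p ∈ plaqsOf (dom (setting189Std bg M₁ plaqT enl4 plaqT4 enl44 XΩ4 Ω Zpp Z Λ OmT ΩppT2 h k₀ k β L₀ α δ B₃ B₅ M O1 ε dist Xhalf XH boxOf chiP devV'' dev97 dev0) j),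
      B15.Ineq180 (dev0 U.1 p) (ε k) (P.eta k) B₃ B₅ M δ (dist p) O1) :
    Claim189 (new189 (setting189Std bg M₁ plaqT enl4 plaqT4 enl44 XΩ4 Ω Zpp Z Λ OmT ΩppT2 h k₀ k β L₀ α δ B₃ B₅ M O1 ε dist Xhalf XH boxOf chiP devV'' dev97 dev0)) (chiPP (setting189Std bg M₁ plaqT enl4 plaqT4 enl44 XΩ4 Ω Zpp Z Λ OmT ΩppT2 h k₀ k β L₀ α δ B₃ B₅ M O1 ε dist Xhalf XH boxOf chiP devV'' dev97 dev0)) :=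
  claim189_assembly (setting189Std bg M₁ plaqT enl4 plaqT4 enl44 XΩ4 Ω Zpp Z Λ OmT ΩppT2 h k₀ k β L₀ α δ B₃ B₅ M O1 ε dist Xhalf XH boxOf chiP devV'' dev97 dev0) hhk hk hΩ hΩtop hα hβ0 hβ hL₀ hL₀L hε0 hε1 hB hδ hdist hX' hsmall hjEqK hlast hscale hbox
    L91h L95 L91 L97 L80

/-! ## Print's instance of the (1.82) letter: p29's `chiPrime182std` (p386208 ✓) -/

section Chart

variable [NormedAddCommGroup 𝔤]

/-- **The (1.82) letter AT PRINT'S INSTANCE** — with `χ′ := B15Sect1ChartInstances.chiPrime182std Ω Zpp Z Λ Ω″^{∼2}_{h+1} h k δ′_k`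
(p29 g41, p386208 ✓: *"χ′ = χ({|B′(b)| < δ′_k for b∈𝔹₀})"*, `𝔹₀ = 𝔹″_k∩Λ₀`, `Λ₀ = Λ∩Ω″^{∼2}_{h+1}`) passed as the letter
`chiP`, every one of the four remaining functions of (1.89) is print's own object: `new189` ↔ [III] (2.17) `χ_k(Ω_k^{∼4}) = 1` ∧
(1.75) `χ_{k,Λ}` ∧ (1.88) `χ_{h,1/2} = 1` ∧ (1.82) `χ′` on the bonds of `𝔹₀` (`h ≤ k`).
[cite: Balaban1989LargeFieldI, (1.89) p.198; (1.82) p.196] -/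
theorem new189_iff_chart (hhk : h ≤ k) (δ'k : ℝ) (U : MSField P G × ((j : ℕ) → VecField P j 𝔤)) :
    new189 (setting189Std bg M₁ plaqT enl4 plaqT4 enl44 XΩ4 Ω Zpp Z Λ OmT ΩppT2 h k₀ k β L₀ α δ B₃ B₅ M O1 ε dist Xhalf XH boxOf
        (chiPrime182std Ω Zpp Z Λ ΩppT2 h k δ'k) devV'' dev97 dev0) U ↔
      chi217 bg M₁ XΩ4 plaqT4 enl44 (ε k) k (U.1 k) = 1 ∧
      chi175std bg M₁ Z Λ k Ω (ε k) (P.eta k) (U.1 k) ∧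
      chiHalf bg M₁ Xhalf plaqT enl4 ε h ΩppT2 (U.1 h) = 1 ∧
      (∀ j, ∀ b ∈ bondsB0 Ω Zpp Z Λ ΩppT2 h k j, ‖U.2 j b‖ < δ'k) := by
  rw [new189_iff bg M₁ plaqT enl4 plaqT4 enl44 XΩ4 Ω Zpp Z Λ OmT ΩppT2 h k₀ k β L₀ α δ B₃ B₅ M O1 ε dist Xhalf XH boxOf
    (chiPrime182std Ω Zpp Z Λ ΩppT2 h k δ'k) devV'' dev97 dev0 hhk]
  exact Iff.rfl

end Chart

end Literature.MathematicalPhysics.QuantumFieldTheory.Balaban1983to89.B15Claim189AtInstances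

end
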